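import Summits.CriticalPhenomena.SAWScalingLimit.Cruxes.MassRatio.Disproof

/-!
# Disproof companion (cycle 3, §J): star algebra at a full interior star, and stub 1 versus the
phase-free modulus floor

Companion workfile of `Cruxes/MassRatio/Disproof.lean` (refuter, `cdisprove`, crux `MassRatio` =
stmt-CriticalPhenomena-8550), split off only because of the workfile size limit; it imports the main
module and lives in the same namespace. `sorry`-free, axioms `propext, Classical.choice, Quot.sound`.

Contents: `star_identity` (inverse DFT at a star: the vertex relation gives `3F_t = S + ω^t T'`),
`star_norm_bounds`, lattice star data `star_up`/`star_down`, `filter_adj_up/_down`,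
`dist_center_le_one`, **`star_bounds`** (`Σ⋆|F_{5/8}| − 2√3|T(v)| ≤ |S(v)| ≤ Σ⋆|F_{5/8}|` at every full
star of a simply connected domain with boundary root, both vertex types; `S` = the plain star sum of
stub 1, `T` = the conjugate defect of `DefectDecoherence`); verbatim copies of the skeleton predicates
`SignalCoherence`, `SignalCoherenceL1` and the phase-free `ModulusFloor`, `ModulusFloorL1`;
`modulusFloor_of_signalCoherence`, `modulusFloorL1_of_signalCoherenceL1` (trivial direction) and
**`signalCoherence_of_modulusFloor`, `signalCoherenceL1_of_modulusFloorL1`** (`DefectDecoherence →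
θ' ≤ 3/4 → ModulusFloor(L1) θ' → SignalCoherence(L1) θ'`): under crux #2 the registered stub
`stub_signalCoherenceL1` is equivalent to the phase-free floor — the three edge phases at a deep star
are aligned up to `O(δ^θ Σ⋆Z)`, so the whole content of stub 1 is a lower bound on `|F_{x_c,5/8}(e)|/Z(e)`
edge by edge (winding characteristic function of walks to ONE mid-edge).
-/

namespace Summit.CriticalPhenomena.SAWScalingLimit.Cruxes.MassRatio.Disproof

open Literature.Probability.LatticeModels Literature.Probability.RandomPlanarGeometry.SAW
open Literature.Probability.RandomPlanarGeometry
open Summit.CriticalPhenomena.SAWScalingLimit.Theses.SAWDefectDecoherence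

/-! ### J.2 Star algebra: the vertex relation makes the three edge values nearly equal -/

/-- `x_c` unfolds to `1/√(2+√2)` (to rewrite the vendored form of Lemma 1). -/
theorem xc_def : hexCriticalFugacity = (Real.sqrt (2 + Real.sqrt 2))⁻¹ := rfl

/-- A primitive cube root of unity has norm one. -/
theorem norm_eq_one_of_cube_root {ω : ℂ} (hω : 1 + ω + ω ^ 2 = 0) : ‖ω‖ = 1 := by
  have h3 : ω ^ 3 = 1 := by linear_combination (ω - 1) * hω
  have : ‖ω‖ ^ 3 = 1 := by rw [← norm_pow, h3, norm_one]
  exact (pow_eq_one_iff_of_nonneg (norm_nonneg ω) (by norm_num)).1 this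

/-- **Inverse DFT at a star.** If `F₀ + ω F₁ + ω² F₂ = 0` (the vertex relation with the common
direction factor `d₀` cancelled, `ω` a primitive cube root of unity), then with the plain star sum
`S = F₀ + F₁ + F₂` and the conjugate-twisted sum `T' = F₀ + ω² F₁ + ω F₂` one has
`3 F_t = S + ω^t T'` for `t = 0, 1, 2`. -/
theorem star_identity {F₀ F₁ F₂ ω : ℂ} (hω : 1 + ω + ω ^ 2 = 0)
    (hVR : F₀ + ω * F₁ + ω ^ 2 * F₂ = 0) :
    3 * F₀ = (F₀ + F₁ + F₂) + (F₀ + ω ^ 2 * F₁ + ω * F₂) ∧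
    3 * F₁ = (F₀ + F₁ + F₂) + ω * (F₀ + ω ^ 2 * F₁ + ω * F₂) ∧
    3 * F₂ = (F₀ + F₁ + F₂) + ω ^ 2 * (F₀ + ω ^ 2 * F₁ + ω * F₂) := by
  refine ⟨?_, ?_, ?_⟩
  · linear_combination hVR - (F₁ + F₂) * hω
  · linear_combination ω ^ 2 * hVR + (-F₀ - 2 * (ω - 1) * F₁ - (1 - ω + ω ^ 2) * F₂) * hω
  · linear_combination ω * hVR + (-F₀ - (1 - ω + ω ^ 2) * F₁ - 2 * (ω - 1) * F₂) * hω

/-- **Two-sided comparison of the plain star sum with the sum of moduli**, given the vertex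
relation: `Σ_t |F_t| - |T'| ≤ |S| ≤ Σ_t |F_t|` and `Σ_t |F_t| ≤ |S| + |T'|`. -/
theorem star_norm_bounds {F₀ F₁ F₂ ω : ℂ} (hω : 1 + ω + ω ^ 2 = 0)
    (hVR : F₀ + ω * F₁ + ω ^ 2 * F₂ = 0) :
    ‖F₀‖ + ‖F₁‖ + ‖F₂‖ ≤ ‖F₀ + F₁ + F₂‖ + ‖F₀ + ω ^ 2 * F₁ + ω * F₂‖ ∧
    ‖F₀‖ + ‖F₁‖ + ‖F₂‖ - ‖F₀ + ω ^ 2 * F₁ + ω * F₂‖ ≤ ‖F₀ + F₁ + F₂‖ := by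
  obtain ⟨h0, h1, h2⟩ := star_identity hω hVR
  have hn := norm_eq_one_of_cube_root hω
  set S := F₀ + F₁ + F₂
  set T := F₀ + ω ^ 2 * F₁ + ω * F₂
  have e0 : ‖3 * F₀‖ = 3 * ‖F₀‖ := by rw [norm_mul]; norm_num
  have e1 : ‖3 * F₁‖ = 3 * ‖F₁‖ := by rw [norm_mul]; norm_num
  have e2 : ‖3 * F₂‖ = 3 * ‖F₂‖ := by rw [norm_mul]; norm_num
  have nT1 : ‖ω * T‖ = ‖T‖ := by rw [norm_mul, hn, one_mul]
  have nT2 : ‖ω ^ 2 * T‖ = ‖T‖ := by rw [norm_mul, norm_pow, hn, one_pow, one_mul]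
  -- upper bounds `3|F_t| ≤ |S| + |T|`
  have u0 : 3 * ‖F₀‖ ≤ ‖S‖ + ‖T‖ := by rw [← e0, h0]; exact norm_add_le _ _
  have u1 : 3 * ‖F₁‖ ≤ ‖S‖ + ‖T‖ := by rw [← e1, h1, ← nT1]; exact norm_add_le _ _
  have u2 : 3 * ‖F₂‖ ≤ ‖S‖ + ‖T‖ := by rw [← e2, h2, ← nT2]; exact norm_add_le _ _
  -- lower bounds `|S| ≥ 3|F_t| - |T|`
  have l0 : 3 * ‖F₀‖ - ‖T‖ ≤ ‖S‖ := by
    have : ‖3 * F₀‖ ≤ ‖S‖ + ‖T‖ := by rw [h0]; exact norm_add_le _ _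
    have hS : S = 3 * F₀ - T := by rw [h0]; ring
    have := norm_sub_le (3 * F₀) T
    rw [← hS, e0] at this
    linarith
  have l1 : 3 * ‖F₁‖ - ‖T‖ ≤ ‖S‖ := by
    have hS : S = 3 * F₁ - ω * T := by rw [h1]; ring
    have := norm_sub_le (3 * F₁) (ω * T)
    rw [← hS, e1, nT1] at this
    linarith
  have l2 : 3 * ‖F₂‖ - ‖T‖ ≤ ‖S‖ := by
    have hS : S = 3 * F₂ - ω ^ 2 * T := by rw [h2]; ring
    have := norm_sub_le (3 * F₂) (ω ^ 2 * T)
    rw [← hS, e2, nT2] at this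
    linarith
  constructor <;> linarith

/-! ### J.3 The honeycomb star in coordinates -/

/-- `ζ³ = -1`. -/
theorem triZeta_cube : triZeta ^ 3 = -1 := by
  have h := triZeta_sq
  linear_combination (triZeta + 1) * h

/-- `ω = ζ²` is a primitive cube root of unity: `1 + ζ² + ζ⁴ = 0`. -/
theorem one_add_zsq_add : 1 + triZeta ^ 2 + (triZeta ^ 2) ^ 2 = 0 := by
  have h := triZeta_sq
  linear_combination (triZeta ^ 2 + triZeta + 1) * h

/-- `conj ζ = 1 - ζ` (`ζ = 1/2 + i√3/2`). -/
theorem conj_triZeta : (starRingEnd ℂ) triZeta = 1 - triZeta := by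
  apply Complex.ext
  · simp; norm_num
  · simp

/-- `conj (ζ²) = ζ⁴` (complex conjugation inverts cube roots of unity). -/
theorem conj_zsq : (starRingEnd ℂ) (triZeta ^ 2) = (triZeta ^ 2) ^ 2 := by
  rw [map_pow, conj_triZeta]
  have h := triZeta_sq
  linear_combination (-(triZeta ^ 2) - triZeta + 1) * h

/-- `1 + ζ ≠ 0`. -/
theorem one_add_triZeta_ne : (1 : ℂ) + triZeta ≠ 0 := by
  intro h
  have := congrArg Complex.im h
  simp at this

/-- `|1 + ζ|² = 3`. -/
theorem normSq_one_add_triZeta : Complex.normSq (1 + triZeta) = 3 := by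
  have h := normSq_add_mul_triZeta 1 1
  push_cast at h
  rw [one_mul] at h
  rw [h]; norm_num

/-- `‖(1 + ζ)/6‖ = 1/(2√3)`, written as `‖(1+ζ)/6‖ * (2 √3) = 1`. -/
theorem norm_one_add_triZeta : ‖(1 : ℂ) + triZeta‖ = Real.sqrt 3 := by
  rw [← Real.sqrt_sq (norm_nonneg _), Complex.sq_norm, normSq_one_add_triZeta]

theorem norm_d₀_mul : ‖(1 + triZeta) / 6‖ * (2 * Real.sqrt 3) = 1 := by
  rw [norm_div, norm_one_add_triZeta]
  have h3 : Real.sqrt 3 * Real.sqrt 3 = 3 := Real.mul_self_sqrt (by norm_num)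
  have h6 : ‖(6:ℂ)‖ = 6 := by simp
  rw [h6]
  nlinarith [h3]

/-- The three neighbours of an up face `(y, 0)` and their half-displacements
`mid{v,t} - c_v = (1+ζ)/6 · ω^t`, `ω = ζ²`. -/
theorem star_up (y : Site 2) :
    hexGraph.Adj (y, 0) (y, 1) ∧ hexGraph.Adj (y, 0) (y - Pi.single 0 1, 1) ∧
      hexGraph.Adj (y, 0) (y - Pi.single 1 1, 1) ∧
    (y, (1 : Fin 2)) ≠ (y - Pi.single 0 1, 1) ∧
      (y - Pi.single 0 1, (1 : Fin 2)) ≠ (y - Pi.single 1 1, 1) ∧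
      (y, (1 : Fin 2)) ≠ (y - Pi.single 1 1, 1) ∧
    hexMidpoint s(((y, 0) : HexVertex), (y, 1)) - hexCenter (y, 0) = (1 + triZeta) / 6 ∧
    hexMidpoint s(((y, 0) : HexVertex), (y - Pi.single 0 1, 1)) - hexCenter (y, 0) =
      (1 + triZeta) / 6 * triZeta ^ 2 ∧
    hexMidpoint s(((y, 0) : HexVertex), (y - Pi.single 1 1, 1)) - hexCenter (y, 0) =
      (1 + triZeta) / 6 * (triZeta ^ 2) ^ 2 := by
  have hsq := triZeta_sq
  refine ⟨?_, ?_, ?_, ?_, ?_, ?_, ?_, ?_, ?_⟩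
  · exact (hexGraph_adj_iff_of_snd_eq_zero_holds y y).2 (Or.inl rfl)
  · exact (hexGraph_adj_iff_of_snd_eq_zero_holds y _).2 (Or.inr (Or.inl rfl))
  · exact (hexGraph_adj_iff_of_snd_eq_zero_holds y _).2 (Or.inr (Or.inr rfl))
  · intro h
    have h' := congrArg (fun v : HexVertex => v.1 0) h
    simp at h'
    omega
  · intro h
    have h' := congrArg (fun v : HexVertex => v.1 0) h
    simp at h'
  · intro h
    have h' := congrArg (fun v : HexVertex => v.1 1) h
    simp at h'
    omega
  · simp only [hexMidpoint_mk, hexCenter, Fin.val_zero, Fin.val_one, Nat.cast_zero, Nat.cast_one]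
    ring
  · simp only [hexMidpoint_mk, hexCenter, Fin.val_zero, Fin.val_one, Nat.cast_zero, Nat.cast_one,
      triEmbed_sub, triEmbed_single_zero]
    linear_combination ((-triZeta - 2) / 6) * hsq
  · simp only [hexMidpoint_mk, hexCenter, Fin.val_zero, Fin.val_one, Nat.cast_zero, Nat.cast_one,
      triEmbed_sub, triEmbed_single_one]
    linear_combination ((-triZeta ^ 3 - 2 * triZeta ^ 2 - triZeta + 1) / 6) * hsq

/-- The three neighbours of a down face `(y, 1)` and their half-displacements
`mid{v,t} - c_v = -(1+ζ)/6 · ω^t`. -/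
theorem star_down (y : Site 2) :
    hexGraph.Adj (y, 1) (y, 0) ∧ hexGraph.Adj (y, 1) (y + Pi.single 0 1, 0) ∧
      hexGraph.Adj (y, 1) (y + Pi.single 1 1, 0) ∧
    (y, (0 : Fin 2)) ≠ (y + Pi.single 0 1, 0) ∧
      (y + Pi.single 0 1, (0 : Fin 2)) ≠ (y + Pi.single 1 1, 0) ∧
      (y, (0 : Fin 2)) ≠ (y + Pi.single 1 1, 0) ∧
    hexMidpoint s(((y, 1) : HexVertex), (y, 0)) - hexCenter (y, 1) = -(1 + triZeta) / 6 ∧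
    hexMidpoint s(((y, 1) : HexVertex), (y + Pi.single 0 1, 0)) - hexCenter (y, 1) =
      -(1 + triZeta) / 6 * triZeta ^ 2 ∧
    hexMidpoint s(((y, 1) : HexVertex), (y + Pi.single 1 1, 0)) - hexCenter (y, 1) =
      -(1 + triZeta) / 6 * (triZeta ^ 2) ^ 2 := by
  have hsq := triZeta_sq
  refine ⟨?_, ?_, ?_, ?_, ?_, ?_, ?_, ?_, ?_⟩
  · exact (hexGraph_adj_iff_of_snd_eq_one y y).2 (Or.inl rfl)
  · exact (hexGraph_adj_iff_of_snd_eq_one y _).2 (Or.inr (Or.inl rfl))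
  · exact (hexGraph_adj_iff_of_snd_eq_one y _).2 (Or.inr (Or.inr rfl))
  · intro h
    have h' := congrArg (fun v : HexVertex => v.1 0) h
    simp at h'
  · intro h
    have h' := congrArg (fun v : HexVertex => v.1 0) h
    simp at h'
  · intro h
    have h' := congrArg (fun v : HexVertex => v.1 1) h
    simp at h'
  · simp only [hexMidpoint_mk, hexCenter, Fin.val_zero, Fin.val_one, Nat.cast_zero, Nat.cast_one]
    ring
  · simp only [hexMidpoint_mk, hexCenter, Fin.val_zero, Fin.val_one, Nat.cast_zero, Nat.cast_one,
      triEmbed_add, triEmbed_single_zero]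
    linear_combination ((triZeta + 2) / 6) * hsq
  · simp only [hexMidpoint_mk, hexCenter, Fin.val_zero, Fin.val_one, Nat.cast_zero, Nat.cast_one,
      triEmbed_add, triEmbed_single_one]
    linear_combination ((triZeta ^ 3 + 2 * triZeta ^ 2 + triZeta - 1) / 6) * hsq


/-- Adjacent centres are at distance `≤ 1` (exactly `1/√3`). -/
theorem dist_center_le_one {v t : HexVertex} (h : hexGraph.Adj v t) :
    dist (hexCenter t) (hexCenter v) ≤ 1 := by
  -- `c_t - c_v = 2 (mid{v,t} - c_v)` and `|mid - c_v| = |1+ζ|/6`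
  have key : ∀ {d₀ : ℂ}, ‖d₀‖ * (2 * Real.sqrt 3) = 1 →
      hexMidpoint s(v, t) - hexCenter v = d₀ ∨ hexMidpoint s(v, t) - hexCenter v = d₀ * triZeta ^ 2 ∨
        hexMidpoint s(v, t) - hexCenter v = d₀ * (triZeta ^ 2) ^ 2 →
      dist (hexCenter t) (hexCenter v) ≤ 1 := by
    intro d₀ hd h3
    have hn1 : ‖triZeta ^ 2‖ = 1 := norm_eq_one_of_cube_root one_add_zsq_add
    have hmid : hexCenter t - hexCenter v = 2 * (hexMidpoint s(v, t) - hexCenter v) := by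
      rw [hexMidpoint_mk]; ring
    have hnorm : ‖hexMidpoint s(v, t) - hexCenter v‖ = ‖d₀‖ := by
      rcases h3 with h | h | h <;> rw [h]
      · rw [norm_mul, hn1, mul_one]
      · rw [norm_mul, norm_pow, hn1, one_pow, mul_one]
    rw [dist_eq_norm, hmid, norm_mul, hnorm]
    have hs3 : (17:ℝ) / 10 < Real.sqrt 3 := sqrt3_gt
    have : ‖(2:ℂ)‖ = 2 := by simp
    rw [this]
    nlinarith [norm_nonneg d₀]
  obtain ⟨y, i⟩ := v
  obtain ⟨z, j⟩ := t
  fin_cases i <;> fin_cases j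
  · exact absurd h (not_hexGraph_adj_of_snd_eq_holds _ _ rfl)
  · obtain ⟨-, -, -, -, -, -, hdp, hdq, hdr⟩ := star_up y
    rcases (hexGraph_adj_iff_of_snd_eq_zero_holds y z).1 h with rfl | rfl | rfl
    · exact key norm_d₀_mul (Or.inl hdp)
    · exact key norm_d₀_mul (Or.inr (Or.inl hdq))
    · exact key norm_d₀_mul (Or.inr (Or.inr hdr))
  · obtain ⟨-, -, -, -, -, -, hdp, hdq, hdr⟩ := star_down y
    have hd' : ‖-(1 + triZeta) / 6‖ * (2 * Real.sqrt 3) = 1 := by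
      rw [neg_div, norm_neg]; exact norm_d₀_mul
    rcases (hexGraph_adj_iff_of_snd_eq_one y z).1 h with rfl | rfl | rfl
    · exact key hd' (Or.inl hdp)
    · exact key hd' (Or.inr (Or.inl hdq))
    · exact key hd' (Or.inr (Or.inr hdr))
  · exact absurd h (not_hexGraph_adj_of_snd_eq_holds _ _ rfl)

/-- The `Λ`-star of an up face all of whose neighbours lie in `Λ`. -/
theorem filter_adj_up {Λ : Finset HexVertex} {y : Site 2} (h1 : ((y, 1) : HexVertex) ∈ Λ)
    (h2 : ((y - Pi.single 0 1, 1) : HexVertex) ∈ Λ)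
    (h3 : ((y - Pi.single 1 1, 1) : HexVertex) ∈ Λ) :
    Λ.filter (fun t => hexGraph.Adj (y, 0) t) =
      {((y, 1) : HexVertex), (y - Pi.single 0 1, 1), (y - Pi.single 1 1, 1)} := by
  ext t
  rw [Finset.mem_filter, Finset.mem_insert, Finset.mem_insert, Finset.mem_singleton]
  constructor
  · rintro ⟨-, hadj⟩
    obtain ⟨z, j⟩ := t
    fin_cases j
    · exact absurd hadj (not_hexGraph_adj_of_snd_eq_holds _ _ rfl)
    · rcases (hexGraph_adj_iff_of_snd_eq_zero_holds y z).1 hadj with rfl | rfl | rfl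
      · exact Or.inl rfl
      · exact Or.inr (Or.inl rfl)
      · exact Or.inr (Or.inr rfl)
  · obtain ⟨hp, hq, hr, -⟩ := star_up y
    rintro (rfl | rfl | rfl)
    · exact ⟨h1, hp⟩
    · exact ⟨h2, hq⟩
    · exact ⟨h3, hr⟩

/-- The `Λ`-star of a down face all of whose neighbours lie in `Λ`. -/
theorem filter_adj_down {Λ : Finset HexVertex} {y : Site 2} (h1 : ((y, 0) : HexVertex) ∈ Λ)
    (h2 : ((y + Pi.single 0 1, 0) : HexVertex) ∈ Λ)
    (h3 : ((y + Pi.single 1 1, 0) : HexVertex) ∈ Λ) :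
    Λ.filter (fun t => hexGraph.Adj (y, 1) t) =
      {((y, 0) : HexVertex), (y + Pi.single 0 1, 0), (y + Pi.single 1 1, 0)} := by
  ext t
  rw [Finset.mem_filter, Finset.mem_insert, Finset.mem_insert, Finset.mem_singleton]
  constructor
  · rintro ⟨-, hadj⟩
    obtain ⟨z, j⟩ := t
    fin_cases j
    · rcases (hexGraph_adj_iff_of_snd_eq_one y z).1 hadj with rfl | rfl | rfl
      · exact Or.inl rfl
      · exact Or.inr (Or.inl rfl)
      · exact Or.inr (Or.inr rfl)
    · exact absurd hadj (not_hexGraph_adj_of_snd_eq_holds _ _ rfl)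
  · obtain ⟨hp, hq, hr, -⟩ := star_down y
    rintro (rfl | rfl | rfl)
    · exact ⟨h1, hp⟩
    · exact ⟨h2, hq⟩
    · exact ⟨h3, hr⟩

/-- **Star bounds from the vertex relation, abstract star data.** For a vertex `v ∈ Λ` of a simply
connected domain with boundary root `a`, whose `Λ`-star is `{p, q, r}` with half-displacements
`d₀ ω^t` (`ω = ζ²`, `|d₀| = 1/(2√3)`): with `F = F_{x_c,5/8}`, `S = Σ⋆ F`, `T = Σ⋆ conj(mid - c_v) F`,
`Σ⋆ |F| - 2√3 |T| ≤ |S|` and `Σ⋆ |F| ≤ |S| + 2√3 |T|`. -/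
theorem star_bounds_of_data {Λ : Finset HexVertex} {a : Sym2 HexVertex} {v p q r : HexVertex}
    {d₀ : ℂ} (hΛ : hexDomainSimplyConnected Λ) (ha : a ∈ hexDomainBoundary Λ) (hv : v ∈ Λ)
    (hp : hexGraph.Adj v p) (hq : hexGraph.Adj v q) (hr : hexGraph.Adj v r)
    (hpq : p ≠ q) (hqr : q ≠ r) (hpr : p ≠ r)
    (hfilter : Λ.filter (fun t => hexGraph.Adj v t) = {p, q, r})
    (hd : ‖d₀‖ * (2 * Real.sqrt 3) = 1)
    (hdp : hexMidpoint s(v, p) - hexCenter v = d₀)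
    (hdq : hexMidpoint s(v, q) - hexCenter v = d₀ * triZeta ^ 2)
    (hdr : hexMidpoint s(v, r) - hexCenter v = d₀ * (triZeta ^ 2) ^ 2) :
    (∑ t ∈ Λ.filter (fun t => hexGraph.Adj v t),
        ‖hexParafermionicObservable Λ a hexCriticalFugacity (5 / 8) s(v, t)‖) -
      2 * Real.sqrt 3 * ‖∑ t ∈ Λ.filter (fun t => hexGraph.Adj v t),
        (starRingEnd ℂ) (hexMidpoint s(v, t) - hexCenter v) *
          hexParafermionicObservable Λ a hexCriticalFugacity (5 / 8) s(v, t)‖ ≤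
      ‖∑ t ∈ Λ.filter (fun t => hexGraph.Adj v t),
        hexParafermionicObservable Λ a hexCriticalFugacity (5 / 8) s(v, t)‖ ∧
    (∑ t ∈ Λ.filter (fun t => hexGraph.Adj v t),
        ‖hexParafermionicObservable Λ a hexCriticalFugacity (5 / 8) s(v, t)‖) ≤
      ‖∑ t ∈ Λ.filter (fun t => hexGraph.Adj v t),
        hexParafermionicObservable Λ a hexCriticalFugacity (5 / 8) s(v, t)‖ +
      2 * Real.sqrt 3 * ‖∑ t ∈ Λ.filter (fun t => hexGraph.Adj v t),
        (starRingEnd ℂ) (hexMidpoint s(v, t) - hexCenter v) *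
          hexParafermionicObservable Λ a hexCriticalFugacity (5 / 8) s(v, t)‖ := by
  set F := hexParafermionicObservable Λ a hexCriticalFugacity (5 / 8) with hF
  have hp' : p ∉ ({q, r} : Finset HexVertex) := by simp [hpq, hpr]
  have hq' : q ∉ ({r} : Finset HexVertex) := by simp [hqr]
  have hsum : ∀ g : HexVertex → ℂ, ∑ t ∈ Λ.filter (fun t => hexGraph.Adj v t), g t = g p + g q + g r := by
    intro g
    rw [hfilter, Finset.sum_insert hp', Finset.sum_insert hq', Finset.sum_singleton, add_assoc]
  have hsumR : ∀ g : HexVertex → ℝ, ∑ t ∈ Λ.filter (fun t => hexGraph.Adj v t), g t = g p + g q + g r := by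
    intro g
    rw [hfilter, Finset.sum_insert hp', Finset.sum_insert hq', Finset.sum_singleton, add_assoc]
  -- the vertex relation
  have hVR0 := DuminilCopinSmirnov2012_lemma1_holds Λ hΛ a ha v hv p q r hp hq hr hpq hqr hpr
  rw [← xc_def, hdp, hdq, hdr] at hVR0
  simp only [← hF] at hVR0
  have hd0 : d₀ ≠ 0 := by
    intro h; rw [h, norm_zero, zero_mul] at hd; exact zero_ne_one hd
  have hVR : F s(v, p) + triZeta ^ 2 * F s(v, q) + (triZeta ^ 2) ^ 2 * F s(v, r) = 0 := by
    apply mul_left_cancel₀ hd0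
    rw [mul_zero]
    linear_combination hVR0
  obtain ⟨hb1, hb2⟩ := star_norm_bounds one_add_zsq_add hVR
  -- the conjugate sum is `conj d₀ · T'`
  have hz3 := triZeta_cube
  have hz8 : (starRingEnd ℂ) ((triZeta ^ 2) ^ 2) = triZeta ^ 2 := by
    rw [map_pow, conj_zsq]
    linear_combination (triZeta ^ 5 - triZeta ^ 2) * hz3
  have hT : ∑ t ∈ Λ.filter (fun t => hexGraph.Adj v t),
      (starRingEnd ℂ) (hexMidpoint s(v, t) - hexCenter v) * F s(v, t) =
      (starRingEnd ℂ) d₀ * (F s(v, p) + (triZeta ^ 2) ^ 2 * F s(v, q) + triZeta ^ 2 * F s(v, r)) := by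
    rw [hsum, hdp, hdq, hdr, map_mul, map_mul, conj_zsq, hz8]
    ring
  have hTn : 2 * Real.sqrt 3 * ‖∑ t ∈ Λ.filter (fun t => hexGraph.Adj v t),
      (starRingEnd ℂ) (hexMidpoint s(v, t) - hexCenter v) * F s(v, t)‖ =
      ‖F s(v, p) + (triZeta ^ 2) ^ 2 * F s(v, q) + triZeta ^ 2 * F s(v, r)‖ := by
    rw [hT, norm_mul, Complex.norm_conj]
    have := hd
    calc 2 * Real.sqrt 3 * (‖d₀‖ * ‖F s(v, p) + (triZeta ^ 2) ^ 2 * F s(v, q) + triZeta ^ 2 * F s(v, r)‖)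
        = (‖d₀‖ * (2 * Real.sqrt 3)) *
            ‖F s(v, p) + (triZeta ^ 2) ^ 2 * F s(v, q) + triZeta ^ 2 * F s(v, r)‖ := by ring
      _ = _ := by rw [hd, one_mul]
  rw [hTn, hsumR, hsum]
  exact ⟨hb2, hb1⟩

/-- **Star bounds at a full interior star** (both vertex types): for `v ∈ Λ` with all three
neighbours in `Λ`, `Σ⋆ |F| - 2√3 |T(v)| ≤ |S(v)| ≤ Σ⋆ |F|` where `S(v) = Σ_{t∼v} F({v,t})` is the
plain star sum of stub 1 and `T(v) = Σ_{t∼v} conj(mid{v,t} - c_v) F({v,t})` the conjugate defect of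
`DefectDecoherence`. -/
theorem star_bounds {Λ : Finset HexVertex} {a : Sym2 HexVertex} {v : HexVertex}
    (hΛ : hexDomainSimplyConnected Λ) (ha : a ∈ hexDomainBoundary Λ) (hv : v ∈ Λ)
    (hnb : ∀ t, hexGraph.Adj v t → t ∈ Λ) :
    (∑ t ∈ Λ.filter (fun t => hexGraph.Adj v t),
        ‖hexParafermionicObservable Λ a hexCriticalFugacity (5 / 8) s(v, t)‖) -
      2 * Real.sqrt 3 * ‖∑ t ∈ Λ.filter (fun t => hexGraph.Adj v t),
        (starRingEnd ℂ) (hexMidpoint s(v, t) - hexCenter v) *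
          hexParafermionicObservable Λ a hexCriticalFugacity (5 / 8) s(v, t)‖ ≤
      ‖∑ t ∈ Λ.filter (fun t => hexGraph.Adj v t),
        hexParafermionicObservable Λ a hexCriticalFugacity (5 / 8) s(v, t)‖ ∧
    (∑ t ∈ Λ.filter (fun t => hexGraph.Adj v t),
        ‖hexParafermionicObservable Λ a hexCriticalFugacity (5 / 8) s(v, t)‖) ≤
      ‖∑ t ∈ Λ.filter (fun t => hexGraph.Adj v t),
        hexParafermionicObservable Λ a hexCriticalFugacity (5 / 8) s(v, t)‖ +
      2 * Real.sqrt 3 * ‖∑ t ∈ Λ.filter (fun t => hexGraph.Adj v t),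
        (starRingEnd ℂ) (hexMidpoint s(v, t) - hexCenter v) *
          hexParafermionicObservable Λ a hexCriticalFugacity (5 / 8) s(v, t)‖ := by
  obtain ⟨y, i⟩ := v
  fin_cases i
  · obtain ⟨hp, hq, hr, hpq, hqr, hpr, hdp, hdq, hdr⟩ := star_up y
    exact star_bounds_of_data hΛ ha hv hp hq hr hpq hqr hpr
      (filter_adj_up (hnb _ hp) (hnb _ hq) (hnb _ hr)) norm_d₀_mul hdp hdq hdr
  · obtain ⟨hp, hq, hr, hpq, hqr, hpr, hdp, hdq, hdr⟩ := star_down y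
    have hd' : ‖-(1 + triZeta) / 6‖ * (2 * Real.sqrt 3) = 1 := by
      rw [neg_div, norm_neg]; exact norm_d₀_mul
    exact star_bounds_of_data hΛ ha hv hp hq hr hpq hqr hpr
      (filter_adj_down (hnb _ hp) (hnb _ hq) (hnb _ hr)) hd' hdp hdq hdr


/-! ### J.4 Stub 1 (pointwise and `K`-summed) versus the phase-free modulus floor -/

/-- `SignalCoherence θ'` — verbatim copy of the skeleton's pointwise floor predicate
(`Lines/coherence-floor-rh-harnack.lean`, round 1; kept there as a sufficient condition). -/
def SignalCoherence (θ' : ℝ) : Prop :=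
  ∀ (D : DobrushinDomain) (ρ : ℝ) (Λ : ℝ → Finset HexVertex) (m : ℝ → ℤ)
    (a b : ℝ → Sym2 HexVertex),
    0 < ρ →
    D.carrier ∩ Metric.ball (D.pt 1) ρ = {z : ℂ | (D.pt 1).im < z.im} ∩ Metric.ball (D.pt 1) ρ →
    (∀ᶠ δ : ℝ in nhdsWithin 0 (Set.Ioi 0),
      hexDomainSimplyConnected (Λ δ) ∧ a δ ∈ hexDomainBoundary (Λ δ) ∧
        b δ ∈ hexDomainBoundary (Λ δ) ∧ Nonempty (HexMidEdgeSAW (Λ δ) (a δ) (b δ)) ∧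
        (hexGraph.induce ((Λ δ : Finset HexVertex) : Set HexVertex)).Preconnected ∧
        (∀ v ∈ Λ δ, (δ : ℂ) * hexCenter v ∈ D.carrier) ∧
        (∀ v : HexVertex, (δ : ℂ) * hexCenter v ∈ Metric.ball (D.pt 1) ρ →
          (v ∈ Λ δ ↔ m δ ≤ v.1 1))) →
    (∀ K : Set ℂ, IsCompact K → K ⊆ D.carrier → ∀ᶠ δ : ℝ in nhdsWithin 0 (Set.Ioi 0),
      ∀ v : HexVertex, (δ : ℂ) * hexCenter v ∈ K → v ∈ Λ δ) →
    Filter.Tendsto (fun δ : ℝ => (δ : ℂ) * hexMidpoint (a δ)) (nhdsWithin 0 (Set.Ioi 0))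
      (nhds (D.pt 0)) →
    Filter.Tendsto (fun δ : ℝ => (δ : ℂ) * hexMidpoint (b δ)) (nhdsWithin 0 (Set.Ioi 0))
      (nhds (D.pt 1)) →
    ∀ K : Set ℂ, IsCompact K → K ⊆ D.carrier → ∃ c : ℝ, 0 < c ∧
      ∀ᶠ δ : ℝ in nhdsWithin 0 (Set.Ioi 0),
        ∀ v : HexVertex, (δ : ℂ) * hexCenter v ∈ K →
        c * δ ^ θ' * (∑ t ∈ (Λ δ).filter (fun t => hexGraph.Adj v t),
            ‖hexParafermionicObservable (Λ δ) (a δ) hexCriticalFugacity 0 s(v, t)‖) ≤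
          ‖∑ t ∈ (Λ δ).filter (fun t => hexGraph.Adj v t),
            hexParafermionicObservable (Λ δ) (a δ) hexCriticalFugacity (5 / 8) s(v, t)‖

/-- `SignalCoherenceL1 θ'` — verbatim copy of the skeleton's `K`-SUMMED floor predicate (reshape 1;
the registered stub `stub_signalCoherenceL1` is `∃ θ' < 3/4, SignalCoherenceL1 θ'`). -/
def SignalCoherenceL1 (θ' : ℝ) : Prop :=
  ∀ (D : DobrushinDomain) (ρ : ℝ) (Λ : ℝ → Finset HexVertex) (m : ℝ → ℤ)
    (a b : ℝ → Sym2 HexVertex),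
    0 < ρ →
    D.carrier ∩ Metric.ball (D.pt 1) ρ = {z : ℂ | (D.pt 1).im < z.im} ∩ Metric.ball (D.pt 1) ρ →
    (∀ᶠ δ : ℝ in nhdsWithin 0 (Set.Ioi 0),
      hexDomainSimplyConnected (Λ δ) ∧ a δ ∈ hexDomainBoundary (Λ δ) ∧
        b δ ∈ hexDomainBoundary (Λ δ) ∧ Nonempty (HexMidEdgeSAW (Λ δ) (a δ) (b δ)) ∧
        (hexGraph.induce ((Λ δ : Finset HexVertex) : Set HexVertex)).Preconnected ∧
        (∀ v ∈ Λ δ, (δ : ℂ) * hexCenter v ∈ D.carrier) ∧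
        (∀ v : HexVertex, (δ : ℂ) * hexCenter v ∈ Metric.ball (D.pt 1) ρ →
          (v ∈ Λ δ ↔ m δ ≤ v.1 1))) →
    (∀ K : Set ℂ, IsCompact K → K ⊆ D.carrier → ∀ᶠ δ : ℝ in nhdsWithin 0 (Set.Ioi 0),
      ∀ v : HexVertex, (δ : ℂ) * hexCenter v ∈ K → v ∈ Λ δ) →
    Filter.Tendsto (fun δ : ℝ => (δ : ℂ) * hexMidpoint (a δ)) (nhdsWithin 0 (Set.Ioi 0))
      (nhds (D.pt 0)) →
    Filter.Tendsto (fun δ : ℝ => (δ : ℂ) * hexMidpoint (b δ)) (nhdsWithin 0 (Set.Ioi 0))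
      (nhds (D.pt 1)) →
    ∀ K : Set ℂ, IsCompact K → K ⊆ D.carrier → ∃ c : ℝ, 0 < c ∧
      ∀ᶠ δ : ℝ in nhdsWithin 0 (Set.Ioi 0),
        c * δ ^ θ' * (∑ᶠ v ∈ {v : HexVertex | v ∈ Λ δ ∧ (δ : ℂ) * hexCenter v ∈ K},
            ∑ t ∈ (Λ δ).filter (fun t => hexGraph.Adj v t),
              ‖hexParafermionicObservable (Λ δ) (a δ) hexCriticalFugacity 0 s(v, t)‖) ≤
          ∑ᶠ v ∈ {v : HexVertex | v ∈ Λ δ ∧ (δ : ℂ) * hexCenter v ∈ K},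
            ‖∑ t ∈ (Λ δ).filter (fun t => hexGraph.Adj v t),
              hexParafermionicObservable (Λ δ) (a δ) hexCriticalFugacity (5 / 8) s(v, t)‖

/-- `ModulusFloor θ'`: the PHASE-FREE floor — the same inequality with the modulus of the star
sum replaced by the star sum of moduli `Σ⋆ |F_{x_c,5/8}|` (pointwise form). -/
def ModulusFloor (θ' : ℝ) : Prop :=
  ∀ (D : DobrushinDomain) (ρ : ℝ) (Λ : ℝ → Finset HexVertex) (m : ℝ → ℤ)
    (a b : ℝ → Sym2 HexVertex),
    0 < ρ →
    D.carrier ∩ Metric.ball (D.pt 1) ρ = {z : ℂ | (D.pt 1).im < z.im} ∩ Metric.ball (D.pt 1) ρ →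
    (∀ᶠ δ : ℝ in nhdsWithin 0 (Set.Ioi 0),
      hexDomainSimplyConnected (Λ δ) ∧ a δ ∈ hexDomainBoundary (Λ δ) ∧
        b δ ∈ hexDomainBoundary (Λ δ) ∧ Nonempty (HexMidEdgeSAW (Λ δ) (a δ) (b δ)) ∧
        (hexGraph.induce ((Λ δ : Finset HexVertex) : Set HexVertex)).Preconnected ∧
        (∀ v ∈ Λ δ, (δ : ℂ) * hexCenter v ∈ D.carrier) ∧
        (∀ v : HexVertex, (δ : ℂ) * hexCenter v ∈ Metric.ball (D.pt 1) ρ →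
          (v ∈ Λ δ ↔ m δ ≤ v.1 1))) →
    (∀ K : Set ℂ, IsCompact K → K ⊆ D.carrier → ∀ᶠ δ : ℝ in nhdsWithin 0 (Set.Ioi 0),
      ∀ v : HexVertex, (δ : ℂ) * hexCenter v ∈ K → v ∈ Λ δ) →
    Filter.Tendsto (fun δ : ℝ => (δ : ℂ) * hexMidpoint (a δ)) (nhdsWithin 0 (Set.Ioi 0))
      (nhds (D.pt 0)) →
    Filter.Tendsto (fun δ : ℝ => (δ : ℂ) * hexMidpoint (b δ)) (nhdsWithin 0 (Set.Ioi 0))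
      (nhds (D.pt 1)) →
    ∀ K : Set ℂ, IsCompact K → K ⊆ D.carrier → ∃ c : ℝ, 0 < c ∧
      ∀ᶠ δ : ℝ in nhdsWithin 0 (Set.Ioi 0),
        ∀ v : HexVertex, (δ : ℂ) * hexCenter v ∈ K →
        c * δ ^ θ' * (∑ t ∈ (Λ δ).filter (fun t => hexGraph.Adj v t),
            ‖hexParafermionicObservable (Λ δ) (a δ) hexCriticalFugacity 0 s(v, t)‖) ≤
          ∑ t ∈ (Λ δ).filter (fun t => hexGraph.Adj v t),
            ‖hexParafermionicObservable (Λ δ) (a δ) hexCriticalFugacity (5 / 8) s(v, t)‖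

/-- `ModulusFloorL1 θ'`: the phase-free floor, `K`-summed. -/
def ModulusFloorL1 (θ' : ℝ) : Prop :=
  ∀ (D : DobrushinDomain) (ρ : ℝ) (Λ : ℝ → Finset HexVertex) (m : ℝ → ℤ)
    (a b : ℝ → Sym2 HexVertex),
    0 < ρ →
    D.carrier ∩ Metric.ball (D.pt 1) ρ = {z : ℂ | (D.pt 1).im < z.im} ∩ Metric.ball (D.pt 1) ρ →
    (∀ᶠ δ : ℝ in nhdsWithin 0 (Set.Ioi 0),
      hexDomainSimplyConnected (Λ δ) ∧ a δ ∈ hexDomainBoundary (Λ δ) ∧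
        b δ ∈ hexDomainBoundary (Λ δ) ∧ Nonempty (HexMidEdgeSAW (Λ δ) (a δ) (b δ)) ∧
        (hexGraph.induce ((Λ δ : Finset HexVertex) : Set HexVertex)).Preconnected ∧
        (∀ v ∈ Λ δ, (δ : ℂ) * hexCenter v ∈ D.carrier) ∧
        (∀ v : HexVertex, (δ : ℂ) * hexCenter v ∈ Metric.ball (D.pt 1) ρ →
          (v ∈ Λ δ ↔ m δ ≤ v.1 1))) →
    (∀ K : Set ℂ, IsCompact K → K ⊆ D.carrier → ∀ᶠ δ : ℝ in nhdsWithin 0 (Set.Ioi 0),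
      ∀ v : HexVertex, (δ : ℂ) * hexCenter v ∈ K → v ∈ Λ δ) →
    Filter.Tendsto (fun δ : ℝ => (δ : ℂ) * hexMidpoint (a δ)) (nhdsWithin 0 (Set.Ioi 0))
      (nhds (D.pt 0)) →
    Filter.Tendsto (fun δ : ℝ => (δ : ℂ) * hexMidpoint (b δ)) (nhdsWithin 0 (Set.Ioi 0))
      (nhds (D.pt 1)) →
    ∀ K : Set ℂ, IsCompact K → K ⊆ D.carrier → ∃ c : ℝ, 0 < c ∧
      ∀ᶠ δ : ℝ in nhdsWithin 0 (Set.Ioi 0),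
        c * δ ^ θ' * (∑ᶠ v ∈ {v : HexVertex | v ∈ Λ δ ∧ (δ : ℂ) * hexCenter v ∈ K},
            ∑ t ∈ (Λ δ).filter (fun t => hexGraph.Adj v t),
              ‖hexParafermionicObservable (Λ δ) (a δ) hexCriticalFugacity 0 s(v, t)‖) ≤
          ∑ᶠ v ∈ {v : HexVertex | v ∈ Λ δ ∧ (δ : ℂ) * hexCenter v ∈ K},
            ∑ t ∈ (Λ δ).filter (fun t => hexGraph.Adj v t),
              ‖hexParafermionicObservable (Λ δ) (a δ) hexCriticalFugacity (5 / 8) s(v, t)‖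

/-- The vertices of `Λ'` with centre in `K` form a finite set. -/
theorem finite_center_set {Λ' : Finset HexVertex} {δ : ℝ} {K : Set ℂ} :
    {v : HexVertex | v ∈ Λ' ∧ (δ : ℂ) * hexCenter v ∈ K}.Finite :=
  Λ'.finite_toSet.subset fun _ hv => hv.1

/-- The `finsum` over `{v ∈ Λ' | δ·c_v ∈ K}` as a `Finset` sum. -/
theorem finsum_center_eq {Λ' : Finset HexVertex} {δ : ℝ} {K : Set ℂ} (f : HexVertex → ℝ) :
    ∑ᶠ v ∈ {v : HexVertex | v ∈ Λ' ∧ (δ : ℂ) * hexCenter v ∈ K}, f v =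
      ∑ v ∈ (finite_center_set (Λ' := Λ') (δ := δ) (K := K)).toFinset, f v :=
  finsum_mem_eq_finite_toFinset_sum f _

/-- Floor ⟹ modulus floor (triangle inequality), pointwise. -/
theorem modulusFloor_of_signalCoherence {θ' : ℝ} (h : SignalCoherence θ') : ModulusFloor θ' := by
  intro D ρ Λ m a b hρ hflat hadm hexh ha hb K hK hKD
  obtain ⟨c, hc, hfl⟩ := h D ρ Λ m a b hρ hflat hadm hexh ha hb K hK hKD
  exact ⟨c, hc, hfl.mono fun δ hδ v hv => (hδ v hv).trans (norm_sum_le _ _)⟩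

/-- Floor ⟹ modulus floor, `K`-summed. -/
theorem modulusFloorL1_of_signalCoherenceL1 {θ' : ℝ} (h : SignalCoherenceL1 θ') :
    ModulusFloorL1 θ' := by
  intro D ρ Λ m a b hρ hflat hadm hexh ha hb K hK hKD
  obtain ⟨c, hc, hfl⟩ := h D ρ Λ m a b hρ hflat hadm hexh ha hb K hK hKD
  refine ⟨c, hc, hfl.mono fun δ hδ => hδ.trans ?_⟩
  rw [finsum_center_eq, finsum_center_eq]
  exact Finset.sum_le_sum fun v _ => norm_sum_le _ _

/-- The eventual per-star package under `DefectDecoherence`: deep in `K`, every vertex is in `Λ_δ`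
with its full star, and `Σ⋆|F| - B δ^{θ'} Σ⋆Z ≤ |S(v)|` with `B ≤ c/2` — for any prescribed `c > 0`
and any `θ' ≤ 3/4`. -/
theorem eventually_star_package (hDD : DefectDecoherence) {θ' c : ℝ} (hθ' : θ' ≤ 3 / 4) (hc : 0 < c)
    {D : DobrushinDomain} {ρ : ℝ} {Λ : ℝ → Finset HexVertex} {m : ℝ → ℤ}
    {a b : ℝ → Sym2 HexVertex}
    (hadm : ∀ᶠ δ : ℝ in nhdsWithin 0 (Set.Ioi 0),
      hexDomainSimplyConnected (Λ δ) ∧ a δ ∈ hexDomainBoundary (Λ δ) ∧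
        b δ ∈ hexDomainBoundary (Λ δ) ∧ Nonempty (HexMidEdgeSAW (Λ δ) (a δ) (b δ)) ∧
        (hexGraph.induce ((Λ δ : Finset HexVertex) : Set HexVertex)).Preconnected ∧
        (∀ v ∈ Λ δ, (δ : ℂ) * hexCenter v ∈ D.carrier) ∧
        (∀ v : HexVertex, (δ : ℂ) * hexCenter v ∈ Metric.ball (D.pt 1) ρ →
          (v ∈ Λ δ ↔ m δ ≤ v.1 1)))
    (hexh : ∀ K : Set ℂ, IsCompact K → K ⊆ D.carrier → ∀ᶠ δ : ℝ in nhdsWithin 0 (Set.Ioi 0),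
      ∀ v : HexVertex, (δ : ℂ) * hexCenter v ∈ K → v ∈ Λ δ)
    {K : Set ℂ} (hK : IsCompact K) (hKD : K ⊆ D.carrier) :
    ∃ B : ℝ, ∀ᶠ δ : ℝ in nhdsWithin 0 (Set.Ioi 0), 0 < δ ∧ B ≤ c / 2 ∧
      ∀ v : HexVertex, (δ : ℂ) * hexCenter v ∈ K → v ∈ Λ δ ∧
        (∑ t ∈ (Λ δ).filter (fun t => hexGraph.Adj v t),
            ‖hexParafermionicObservable (Λ δ) (a δ) hexCriticalFugacity (5 / 8) s(v, t)‖) -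
          B * δ ^ θ' * (∑ t ∈ (Λ δ).filter (fun t => hexGraph.Adj v t),
            ‖hexParafermionicObservable (Λ δ) (a δ) hexCriticalFugacity 0 s(v, t)‖) ≤
        ‖∑ t ∈ (Λ δ).filter (fun t => hexGraph.Adj v t),
            hexParafermionicObservable (Λ δ) (a δ) hexCriticalFugacity (5 / 8) s(v, t)‖ := by
  obtain ⟨C, θ, hθ, hdd⟩ := hDD
  obtain ⟨d, hd, hdD⟩ := hK.exists_cthickening_subset_open D.isOpen hKD
  have hex₁ := hexh (Metric.cthickening d K) hK.cthickening hdD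
  set A : ℝ := 2 * Real.sqrt 3 * max C 0 * d ^ (-θ) with hA
  have hA0 : 0 ≤ A := by positivity
  have hε : 0 < c / (2 * (A + 1)) := by positivity
  have hpow : ∀ᶠ δ : ℝ in nhdsWithin 0 (Set.Ioi 0), δ ^ (θ - θ') < c / (2 * (A + 1)) := by
    have hcont : Filter.Tendsto (fun δ : ℝ => δ ^ (θ - θ')) (nhdsWithin 0 (Set.Ioi 0)) (nhds 0) := by
      have h := (Real.continuousAt_rpow_const 0 (θ - θ') (Or.inr (by linarith))).tendsto
      rw [Real.zero_rpow (by linarith)] at h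
      exact tendsto_nhdsWithin_of_tendsto_nhds h
    exact hcont (Iio_mem_nhds hε)
  have hsmall : ∀ᶠ δ : ℝ in nhdsWithin 0 (Set.Ioi 0), δ ∈ Set.Ioo 0 (min 1 d) :=
    Ioo_mem_nhdsGT (lt_min one_pos hd)
  -- `B = A δ^{θ-θ'}` depends on `δ`; we bound it by the constant `c/2` and use `B := c/2`
  refine ⟨c / 2, ?_⟩
  filter_upwards [hadm, hex₁, hsmall, hpow] with δ hadmδ hex hδ hpowδ
  obtain ⟨hδ0, hδ1⟩ := hδ
  have hδd : δ ≤ d := ((lt_min_iff.1 hδ1).2).le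
  refine ⟨hδ0, le_rfl, fun v hvK => ?_⟩
  obtain ⟨hsc, haδ, -, -, -, -, -⟩ := hadmδ
  obtain ⟨hedge, u, w, hauw, hwΛ, huΛ⟩ := haδ
  have huw : hexGraph.Adj u w := by
    rw [hauw] at hedge; exact (SimpleGraph.mem_edgeSet _).1 hedge
  have hR : 1 ≤ d / δ := by rw [le_div_iff₀ hδ0]; linarith
  have hdeep : ∀ y : HexVertex, dist (hexCenter y) (hexCenter v) ≤ d / δ → y ∈ Λ δ := by
    intro y hy
    refine hex y (Metric.mem_cthickening_of_dist_le _ _ _ _ hvK ?_)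
    rw [dist_eq_norm] at hy ⊢
    rw [← mul_sub, norm_mul, Complex.norm_real, Real.norm_of_nonneg hδ0.le]
    calc δ * ‖hexCenter y - hexCenter v‖ ≤ δ * (d / δ) := by gcongr
      _ = d := mul_div_cancel₀ _ hδ0.ne'
  have hvΛ : v ∈ Λ δ := hdeep v (by rw [dist_self]; positivity)
  have hnb : ∀ t, hexGraph.Adj v t → t ∈ Λ δ := fun t ht => hdeep t ((dist_center_le_one ht).trans hR)
  have hT := hdd (Λ δ) hsc u w huw huΛ hwΛ v (d / δ) hR hdeep
  rw [← hauw] at hT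
  have hstar := (star_bounds hsc ⟨hedge, u, w, hauw, hwΛ, huΛ⟩ hvΛ hnb).1
  refine ⟨hvΛ, ?_⟩
  -- names for the four star quantities
  set Zs := ∑ t ∈ (Λ δ).filter (fun t => hexGraph.Adj v t),
    ‖hexParafermionicObservable (Λ δ) (a δ) hexCriticalFugacity 0 s(v, t)‖ with hZs
  set Fs := ∑ t ∈ (Λ δ).filter (fun t => hexGraph.Adj v t),
    ‖hexParafermionicObservable (Λ δ) (a δ) hexCriticalFugacity (5 / 8) s(v, t)‖ with hFs
  set Tn := ‖∑ t ∈ (Λ δ).filter (fun t => hexGraph.Adj v t),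
    (starRingEnd ℂ) (hexMidpoint s(v, t) - hexCenter v) *
      hexParafermionicObservable (Λ δ) (a δ) hexCriticalFugacity (5 / 8) s(v, t)‖ with hTn
  have hZs0 : 0 ≤ Zs := Finset.sum_nonneg (fun _ _ => norm_nonneg _)
  have halg : (d / δ) ^ (-θ) = d ^ (-θ) * δ ^ θ := by
    rw [Real.div_rpow hd.le hδ0.le, Real.rpow_neg hδ0.le, div_inv_eq_mul]
  have hsplit : δ ^ θ = δ ^ (θ - θ') * δ ^ θ' := by
    rw [← Real.rpow_add hδ0]; ring_nf
  set P := δ ^ θ' * Zs with hP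
  have hP0 : 0 ≤ P := by positivity
  -- `2√3 |T| ≤ A δ^{θ-θ'} P`
  have hT1 : Tn ≤ max C 0 * (d / δ) ^ (-θ) * Zs :=
    hT.trans (by gcongr; exact le_max_left _ _)
  have hT2 : 2 * Real.sqrt 3 * Tn ≤ (A * δ ^ (θ - θ')) * P := by
    have := mul_le_mul_of_nonneg_left hT1 (show (0:ℝ) ≤ 2 * Real.sqrt 3 by positivity)
    calc 2 * Real.sqrt 3 * Tn ≤ 2 * Real.sqrt 3 * (max C 0 * (d / δ) ^ (-θ) * Zs) := this
      _ = (A * δ ^ (θ - θ')) * P := by rw [halg, hsplit, hA, hP]; ring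
  -- `A δ^{θ-θ'} ≤ c/2`
  have hsm : A * δ ^ (θ - θ') ≤ c / 2 := by
    have h1 : A * δ ^ (θ - θ') ≤ A * (c / (2 * (A + 1))) :=
      mul_le_mul_of_nonneg_left hpowδ.le hA0
    have h2 : A * (c / (2 * (A + 1))) = c / 2 * (A / (A + 1)) := by field_simp
    have h3 : A / (A + 1) ≤ 1 := div_le_one_of_le₀ (by linarith) (by positivity)
    calc A * δ ^ (θ - θ') ≤ c / 2 * (A / (A + 1)) := h1.trans h2.le
      _ ≤ c / 2 * 1 := mul_le_mul_of_nonneg_left h3 (by positivity)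
      _ = c / 2 := mul_one _
  have hT3 : (A * δ ^ (θ - θ')) * P ≤ c / 2 * P := mul_le_mul_of_nonneg_right hsm hP0
  have e : c / 2 * δ ^ θ' * Zs = c / 2 * P := by rw [hP]; ring
  rw [e]
  linarith

/-- **Under `DefectDecoherence`, stub 1 is equivalent to the phase-free modulus floor (pointwise
form).** The vertex relation aligns the three edge values up to the conjugate defect
(`3F_t = S + ω^t T'`), and crux #2 says the defect is `o(δ^{3/4}) Σ⋆Z`; so at every `θ' ≤ 3/4` the
floor `c δ^{θ'} Σ⋆Z ≤ |S|` holds iff `c' δ^{θ'} Σ⋆Z ≤ Σ⋆|F|` does. What remains of stub 1 is thus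
a bound on the modulus `|F_{x_c,5/8}(e)|` of the winding characteristic function of walks to ONE
mid-edge — the relative phases of the three edges are not the issue. -/
theorem signalCoherence_of_modulusFloor (hDD : DefectDecoherence) {θ' : ℝ} (hθ' : θ' ≤ 3 / 4)
    (hMF : ModulusFloor θ') : SignalCoherence θ' := by
  intro D ρ Λ m a b hρ hflat hadm hexh ha hb K hK hKD
  obtain ⟨c, hc, hmf⟩ := hMF D ρ Λ m a b hρ hflat hadm hexh ha hb K hK hKD
  obtain ⟨B, hpk⟩ := eventually_star_package hDD hθ' hc hadm hexh hK hKD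
  refine ⟨c / 2, by positivity, ?_⟩
  filter_upwards [hmf, hpk] with δ hmfδ hpkδ
  obtain ⟨hδ0, hB, hv⟩ := hpkδ
  intro v hvK
  obtain ⟨-, hst⟩ := hv v hvK
  have hm := hmfδ v hvK
  have hZ0 : 0 ≤ δ ^ θ' * ∑ t ∈ (Λ δ).filter (fun t => hexGraph.Adj v t),
      ‖hexParafermionicObservable (Λ δ) (a δ) hexCriticalFugacity 0 s(v, t)‖ :=
    mul_nonneg (Real.rpow_nonneg hδ0.le _) (Finset.sum_nonneg (fun _ _ => norm_nonneg _))
  nlinarith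

/-- **Under `DefectDecoherence`, the registered stub `stub_signalCoherenceL1` is equivalent to the
`K`-summed modulus floor** (`ModulusFloorL1 θ' → SignalCoherenceL1 θ'` for `θ' ≤ 3/4`; the
converse is `modulusFloorL1_of_signalCoherenceL1`). -/
theorem signalCoherenceL1_of_modulusFloorL1 (hDD : DefectDecoherence) {θ' : ℝ} (hθ' : θ' ≤ 3 / 4)
    (hMF : ModulusFloorL1 θ') : SignalCoherenceL1 θ' := by
  intro D ρ Λ m a b hρ hflat hadm hexh ha hb K hK hKD
  obtain ⟨c, hc, hmf⟩ := hMF D ρ Λ m a b hρ hflat hadm hexh ha hb K hK hKD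
  obtain ⟨B, hpk⟩ := eventually_star_package hDD hθ' hc hadm hexh hK hKD
  refine ⟨c / 2, by positivity, (hmf.and hpk).mono fun δ hδ => ?_⟩
  obtain ⟨hmfδ, hδ0, hB, hv⟩ := hδ
  have hS := finite_center_set (Λ' := Λ δ) (δ := δ) (K := K)
  rw [finsum_center_eq, finsum_center_eq] at hmfδ ⊢
  rw [Finset.mul_sum] at hmfδ ⊢
  -- sum the per-star package over the `K`-stars
  have key : ∀ v ∈ hS.toFinset,
      c / 2 * δ ^ θ' * (∑ t ∈ (Λ δ).filter (fun t => hexGraph.Adj v t),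
          ‖hexParafermionicObservable (Λ δ) (a δ) hexCriticalFugacity 0 s(v, t)‖) ≤
        ‖∑ t ∈ (Λ δ).filter (fun t => hexGraph.Adj v t),
            hexParafermionicObservable (Λ δ) (a δ) hexCriticalFugacity (5 / 8) s(v, t)‖ -
        ((∑ t ∈ (Λ δ).filter (fun t => hexGraph.Adj v t),
            ‖hexParafermionicObservable (Λ δ) (a δ) hexCriticalFugacity (5 / 8) s(v, t)‖) -
          c * δ ^ θ' * (∑ t ∈ (Λ δ).filter (fun t => hexGraph.Adj v t),
            ‖hexParafermionicObservable (Λ δ) (a δ) hexCriticalFugacity 0 s(v, t)‖)) := by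
    intro v hvS
    obtain ⟨-, hst⟩ := hv v (hS.mem_toFinset.1 hvS).2
    have hZ0 : 0 ≤ δ ^ θ' * ∑ t ∈ (Λ δ).filter (fun t => hexGraph.Adj v t),
        ‖hexParafermionicObservable (Λ δ) (a δ) hexCriticalFugacity 0 s(v, t)‖ :=
      mul_nonneg (Real.rpow_nonneg hδ0.le _) (Finset.sum_nonneg (fun _ _ => norm_nonneg _))
    nlinarith
  have hsum := Finset.sum_le_sum key
  rw [Finset.sum_sub_distrib, Finset.sum_sub_distrib] at hsum
  linarith

end Summit.CriticalPhenomena.SAWScalingLimit.Cruxes.MassRatio.Disproof
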